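import Mathlib
import Summits.MatrixMultiplication.MatrixMultiplication.Theorems.SnSubsetDichotomyPolynomialSlackDepletedArea
import Summits.MatrixMultiplication.MatrixMultiplication.Theorems.SnSubsetDichotomyPolynomialSlackAtomBasicFacts
import Summits.MatrixMultiplication.MatrixMultiplication.Theorems.SnSubsetDichotomyPolynomialSlackStubSplit

/-!
# The sub-uniform part of a column keeps almost nothing (3/4 step)

Crux `Summit.MatrixMultiplication.MatrixMultiplication.Theses.SnSubsetDichotomy.PolynomialSlack`
(item `stmt-MatrixMultiplication-8306`), level-one programme, line transport-split-hull (lead c10).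
At a hub position `k` the 3/4 step decomposes the FULL column `dB(·,k)` as `dB = pB + w` with
`pB = (dB - 1/n)·[dB ≥ 16/n]` the heavy part used by c9's atom chain (threshold `θB = 16/n`) and the
SUB-UNIFORM weight `w j = 1/n` on heavy `j`, `w j = dB(j,k)` on light `j` (`0 ≤ w ≤ 16/n`,
`Σ w ≤ 1`).  The kept value carried by `w` against the masked heavy row `pC(k,·)`,
`(n-1) Σ_{i ∉ Qm} pC(k,i) Σ_j w j (1/n - dA(i,j))`, is at most `ε₂ R + 5 (1+log n) ε₁ (R+1) + R/n`,
`R = Σ_{i ∉ Qm} pC(k,i)`, provided no substantial masked S-level has a small block (`hbig`, the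
no-pinned-S-win consequence) — `subuniform_kept_le`.

Proof.  Split `j` into the dyadic levels `J_a = {1/n² ≤ w, ⌊log₂(1/w)⌋ = a}` of `w` plus the dust
`D = {w < 1/n²}` and `i` into the masked S-levels `I_b` (at most `⌊log₂ n²⌋ + 1 ≤ 3(1 + log n)`
levels each); `σ_a = Σ_{J_a} w` (`Σ_a σ_a ≤ Σ_j dB(j,k) = 1`), `ρ_b = Σ_{I_b} pC` (`Σ_b ρ_b = R`).
The dust keeps `≤ R/n`; a block pair keeps trivially `≤ ρ_b σ_a` (`blockPair_kept_le_trivial`), so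
a level `a` with `σ_a < ε₁` keeps `≤ ε₁ R` and, inside a substantial level `a`, the `b` with
`ρ_b < ε₁` keep `≤ ε₁ σ_a`; a substantial pair (`σ_a, ρ_b ≥ ε₁`) is NOT depleted
(`subuniform_pair_not_depleted`: a depleted flat block has area `|I_b||J_a| ≤ A₀` by
`area_le_of_depleted_flat_block`, while `|J_a| ≥ ε₁ n/16` as `w ≤ 16/n` and `|I_b| > 32 A₀/(ε₁ n)`
by `hbig`), so it keeps `≤ ε₂ σ_a ρ_b` (`blockPair_kept_le_of_not_depleted`).  Summing
(`subuniform_kept_bookkeeping`): `≤ R/n + 3(1+log n) ε₁ R + 3(1+log n) ε₁ + ε₂ R`.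
-/

namespace Summit.MatrixMultiplication.MatrixMultiplication.Theorems.PolynomialSlack

open scoped BigOperators
open Literature.Combinatorics.Additive (TripleProductProperty)

set_option linter.dupNamespace false

/-! ## One block pair -/

/-- The kept value of a block pair `X × Y` in closed form:
`Σ_{i∈X} P i Σ_{j∈Y} w j (1/N - dA i j) = (Σ_X P)(Σ_Y w)/N - Σ_{X×Y} dA w P`. [folklore] -/
theorem blockPair_kept_eq {ι : Type*} (X Y : Finset ι) (P w : ι → ℝ) (dA : ι → ι → ℝ) (N : ℝ) :
    ∑ i ∈ X, P i * ∑ j ∈ Y, w j * (1 / N - dA i j) =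
      (∑ i ∈ X, P i) * (∑ j ∈ Y, w j) / N - ∑ i ∈ X, ∑ j ∈ Y, dA i j * w j * P i := by
  rw [Finset.sum_mul_sum, Finset.sum_div, ← Finset.sum_sub_distrib]
  refine Finset.sum_congr rfl fun i _ => ?_
  rw [Finset.mul_sum, Finset.sum_div, ← Finset.sum_sub_distrib]
  refine Finset.sum_congr rfl fun j _ => ?_
  ring

/-- The trivial bound on the kept value of a block pair (drop `-dA ≤ 0`, then `(N-1)/N ≤ 1`):
`(N-1) Σ_{i∈X} P i Σ_{j∈Y} w j (1/N - dA i j) ≤ (Σ_X P)(Σ_Y w)` for `P, w, dA ≥ 0`, `N ≥ 1`.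
[folklore] -/
theorem blockPair_kept_le_trivial {ι : Type*} (X Y : Finset ι) (P w : ι → ℝ) (dA : ι → ι → ℝ)
    (N : ℝ) (hN : 1 ≤ N) (hP0 : ∀ i, 0 ≤ P i) (hw0 : ∀ j, 0 ≤ w j) (hdA0 : ∀ i j, 0 ≤ dA i j) :
    (N - 1) * ∑ i ∈ X, P i * ∑ j ∈ Y, w j * (1 / N - dA i j) ≤
      (∑ i ∈ X, P i) * ∑ j ∈ Y, w j := by
  have hN0 : 0 < N := by linarith
  rw [blockPair_kept_eq]
  have hA : 0 ≤ ∑ i ∈ X, P i := Finset.sum_nonneg fun i _ => hP0 i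
  have hB : 0 ≤ ∑ j ∈ Y, w j := Finset.sum_nonneg fun j _ => hw0 j
  have hD : 0 ≤ ∑ i ∈ X, ∑ j ∈ Y, dA i j * w j * P i :=
    Finset.sum_nonneg fun i _ => Finset.sum_nonneg fun j _ =>
      mul_nonneg (mul_nonneg (hdA0 i j) (hw0 j)) (hP0 i)
  have ht : 0 ≤ (∑ i ∈ X, P i) * (∑ j ∈ Y, w j) / N := div_nonneg (mul_nonneg hA hB) hN0.le
  have hC : (∑ i ∈ X, P i) * (∑ j ∈ Y, w j) / N * N = (∑ i ∈ X, P i) * ∑ j ∈ Y, w j :=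
    div_mul_cancel₀ _ hN0.ne'
  linarith [mul_nonneg (sub_nonneg.2 hN) hD]

/-- The non-depleted bound on the kept value of a block pair: if
`Σ_{X×Y} dA w P > (1-ε)(Σ_Y w)(Σ_X P)/N` then
`(N-1) Σ_{i∈X} P i Σ_{j∈Y} w j (1/N - dA i j) ≤ ε (Σ_Y w)(Σ_X P)`. [folklore] -/
theorem blockPair_kept_le_of_not_depleted {ι : Type*} (X Y : Finset ι) (P w : ι → ℝ)
    (dA : ι → ι → ℝ) (N ε : ℝ) (hN : 1 ≤ N) (hε : 0 ≤ ε) (hP0 : ∀ i, 0 ≤ P i)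
    (hw0 : ∀ j, 0 ≤ w j)
    (hnd : (1 - ε) * ((∑ j ∈ Y, w j) * (∑ i ∈ X, P i)) / N <
      ∑ i ∈ X, ∑ j ∈ Y, dA i j * w j * P i) :
    (N - 1) * ∑ i ∈ X, P i * ∑ j ∈ Y, w j * (1 / N - dA i j) ≤
      ε * (∑ j ∈ Y, w j) * ∑ i ∈ X, P i := by
  have hN0 : 0 < N := by linarith
  rw [blockPair_kept_eq]
  have hA : 0 ≤ ∑ i ∈ X, P i := Finset.sum_nonneg fun i _ => hP0 i
  have hB : 0 ≤ ∑ j ∈ Y, w j := Finset.sum_nonneg fun j _ => hw0 j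
  have h1 : (∑ i ∈ X, P i) * (∑ j ∈ Y, w j) / N - ∑ i ∈ X, ∑ j ∈ Y, dA i j * w j * P i ≤
      ε * ((∑ j ∈ Y, w j) * ∑ i ∈ X, P i) / N := by
    have e : (1 - ε) * ((∑ j ∈ Y, w j) * ∑ i ∈ X, P i) / N =
        (∑ i ∈ X, P i) * (∑ j ∈ Y, w j) / N - ε * ((∑ j ∈ Y, w j) * ∑ i ∈ X, P i) / N := by
      ring
    linarith
  calc (N - 1) * ((∑ i ∈ X, P i) * (∑ j ∈ Y, w j) / N - ∑ i ∈ X, ∑ j ∈ Y, dA i j * w j * P i)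
      ≤ (N - 1) * (ε * ((∑ j ∈ Y, w j) * ∑ i ∈ X, P i) / N) :=
        mul_le_mul_of_nonneg_left h1 (by linarith)
    _ = ε * (∑ j ∈ Y, w j) * (∑ i ∈ X, P i) * ((N - 1) / N) := by ring
    _ ≤ ε * (∑ j ∈ Y, w j) * (∑ i ∈ X, P i) * 1 :=
        mul_le_mul_of_nonneg_left (by rw [div_le_one hN0]; linarith)
          (mul_nonneg (mul_nonneg hε hB) hA)
    _ = ε * (∑ j ∈ Y, w j) * ∑ i ∈ X, P i := mul_one _

/-! ## The bookkeeping over the two splittings -/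

/-- **Sub-uniform kept value: the bookkeeping.**  Abstract form of `subuniform_kept_le`: `P ≥ 0`
(sums over `F` split over levels `I b`), `w ≥ 0`, `Σ w ≤ 1` (`w`-weighted sums split into the dust
`D` — `w ≤ 1/N²`, `|D| ≤ N` — plus levels `J a`), `≤ 3G` levels, `dA ≥ 0`, substantial pairs
(`Σ_{J a} w, Σ_{I b} P ≥ ε₁`) non-depleted; then `(N-1) Σ_{i∈F} P i Σ_j w j (1/N - dA i j) ≤
ε₂ R + 5 G ε₁ (R+1) + R/N` (dust `≤ R/N`; level `a` keeps `≤ ε₁ R + (3Gε₁ + ε₂ R) Σ_{J a} w`).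
[folklore] -/
theorem subuniform_kept_bookkeeping {ι : Type*} [Fintype ι] {m : ℕ} (N G ε₁ ε₂ R : ℝ)
    (hN : 1 ≤ N) (hm : (m : ℝ) ≤ 3 * G) (hε₁ : 0 < ε₁) (hε₂ : 0 < ε₂) (P w : ι → ℝ)
    (dA : ι → ι → ℝ) (F D : Finset ι) (I J : Fin m → Finset ι) (hR : R = ∑ i ∈ F, P i)
    (hP0 : ∀ i, 0 ≤ P i) (hw0 : ∀ j, 0 ≤ w j) (hw1 : ∑ j, w j ≤ 1) (hdA0 : ∀ i j, 0 ≤ dA i j)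
    (hD : ∀ j ∈ D, w j ≤ 1 / N ^ 2) (hDcard : (D.card : ℝ) ≤ N)
    (hsplitJ : ∀ f : ι → ℝ,
      ∑ j, w j * f j = ∑ j ∈ D, w j * f j + ∑ a, ∑ j ∈ J a, w j * f j)
    (hsplitI : ∀ g : ι → ℝ, ∑ i ∈ F, P i * g i = ∑ b, ∑ i ∈ I b, P i * g i)
    (hnodep : ∀ a b, ε₁ ≤ ∑ j ∈ J a, w j → ε₁ ≤ ∑ i ∈ I b, P i →
      (1 - ε₂) * ((∑ j ∈ J a, w j) * (∑ i ∈ I b, P i)) / N <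
        ∑ i ∈ I b, ∑ j ∈ J a, dA i j * w j * P i) :
    (N - 1) * ∑ i ∈ F, P i * ∑ j, w j * (1 / N - dA i j) ≤
      ε₂ * R + 5 * G * ε₁ * (R + 1) + R / N := by
  have hN0 : 0 < N := by linarith
  have hG0 : 0 ≤ G := by linarith [(Nat.cast_nonneg m : (0 : ℝ) ≤ m)]
  have hR0 : 0 ≤ R := by rw [hR]; exact Finset.sum_nonneg fun i _ => hP0 i
  have hσ0 : ∀ a, 0 ≤ ∑ j ∈ J a, w j := fun a => Finset.sum_nonneg fun j _ => hw0 j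
  have hρ0 : ∀ b, 0 ≤ ∑ i ∈ I b, P i := fun b => Finset.sum_nonneg fun i _ => hP0 i
  have hcoef : 0 ≤ 3 * G * ε₁ + ε₂ * R :=
    add_nonneg (mul_nonneg (mul_nonneg (by norm_num) hG0) hε₁.le) (mul_nonneg hε₂.le hR0)
  /- `Σ_b ρ_b = R` and `Σ_a σ_a ≤ 1` -/
  have hRρ : ∑ b, ∑ i ∈ I b, P i = R := by
    rw [hR]; simpa only [mul_one] using (hsplitI fun _ => 1).symm
  have hσ1 : ∑ a, ∑ j ∈ J a, w j ≤ 1 := by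
    have h := hsplitJ fun _ => 1
    simp only [mul_one] at h
    linarith [Finset.sum_nonneg fun j (_ : j ∈ D) => hw0 j]
  /- split the `j`-sums into the dust and the levels of `w` -/
  have hexp : ∑ i ∈ F, P i * ∑ j, w j * (1 / N - dA i j) =
      ∑ i ∈ F, P i * ∑ j ∈ D, w j * (1 / N - dA i j) +
        ∑ a, ∑ i ∈ F, P i * ∑ j ∈ J a, w j * (1 / N - dA i j) := by
    have e : ∀ i, P i * ∑ j, w j * (1 / N - dA i j) =
        P i * ∑ j ∈ D, w j * (1 / N - dA i j) +
          ∑ a, P i * ∑ j ∈ J a, w j * (1 / N - dA i j) := by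
      intro i
      rw [hsplitJ (fun j => 1 / N - dA i j)]
      simp only [mul_add, Finset.mul_sum]
    rw [Finset.sum_congr rfl fun i _ => e i, Finset.sum_add_distrib, add_right_inj]
    exact Finset.sum_comm
  /- the dust keeps `≤ R/N` -/
  have hdust : (N - 1) * ∑ i ∈ F, P i * ∑ j ∈ D, w j * (1 / N - dA i j) ≤ R / N := by
    have h1 := blockPair_kept_le_trivial F D P w dA N hN hP0 hw0 hdA0
    rw [← hR] at h1
    have h2 : ∑ j ∈ D, w j ≤ 1 / N := by
      calc ∑ j ∈ D, w j ≤ ∑ j ∈ D, (1 / N ^ 2 : ℝ) := Finset.sum_le_sum hD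
        _ = D.card * (1 / N ^ 2) := by rw [Finset.sum_const, nsmul_eq_mul]
        _ ≤ N * (1 / N ^ 2) := mul_le_mul_of_nonneg_right hDcard (by positivity)
        _ = 1 / N := by rw [one_div, one_div, ← div_eq_mul_inv, sq, div_mul_cancel_right₀ hN0.ne']
    calc (N - 1) * ∑ i ∈ F, P i * ∑ j ∈ D, w j * (1 / N - dA i j) ≤ R * ∑ j ∈ D, w j := h1
      _ ≤ R * (1 / N) := mul_le_mul_of_nonneg_left h2 hR0
      _ = R / N := mul_one_div R N
  /- one level `a` of `w` keeps `≤ ε₁ R + (3Gε₁ + ε₂ R) σ_a` -/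
  have hlevel : ∀ a, (N - 1) * ∑ i ∈ F, P i * ∑ j ∈ J a, w j * (1 / N - dA i j) ≤
      ε₁ * R + (3 * G * ε₁ + ε₂ * R) * ∑ j ∈ J a, w j := by
    intro a
    by_cases ha : ∑ j ∈ J a, w j < ε₁
    · -- an insubstantial level of `w`: the trivial bound
      have h1 := blockPair_kept_le_trivial F (J a) P w dA N hN hP0 hw0 hdA0
      rw [← hR] at h1
      calc (N - 1) * ∑ i ∈ F, P i * ∑ j ∈ J a, w j * (1 / N - dA i j)
          ≤ R * ∑ j ∈ J a, w j := h1
        _ ≤ R * ε₁ := mul_le_mul_of_nonneg_left ha.le hR0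
        _ = ε₁ * R := mul_comm _ _
        _ ≤ ε₁ * R + (3 * G * ε₁ + ε₂ * R) * ∑ j ∈ J a, w j :=
            le_add_of_nonneg_right (mul_nonneg hcoef (hσ0 a))
    · -- a substantial level of `w`: split `i` over the levels of `P`
      push Not at ha
      rw [hsplitI (fun i => ∑ j ∈ J a, w j * (1 / N - dA i j)), Finset.mul_sum]
      have hb : ∀ b, (N - 1) * ∑ i ∈ I b, P i * ∑ j ∈ J a, w j * (1 / N - dA i j) ≤
          ε₁ * ∑ j ∈ J a, w j + ε₂ * (∑ j ∈ J a, w j) * ∑ i ∈ I b, P i := by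
        intro b
        by_cases hbρ : ∑ i ∈ I b, P i < ε₁
        · calc (N - 1) * ∑ i ∈ I b, P i * ∑ j ∈ J a, w j * (1 / N - dA i j)
              ≤ (∑ i ∈ I b, P i) * ∑ j ∈ J a, w j :=
                blockPair_kept_le_trivial (I b) (J a) P w dA N hN hP0 hw0 hdA0
            _ ≤ ε₁ * ∑ j ∈ J a, w j := mul_le_mul_of_nonneg_right hbρ.le (hσ0 a)
            _ ≤ ε₁ * ∑ j ∈ J a, w j + ε₂ * (∑ j ∈ J a, w j) * ∑ i ∈ I b, P i :=
                le_add_of_nonneg_right (mul_nonneg (mul_nonneg hε₂.le (hσ0 a)) (hρ0 b))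
        · push Not at hbρ
          calc (N - 1) * ∑ i ∈ I b, P i * ∑ j ∈ J a, w j * (1 / N - dA i j)
              ≤ ε₂ * (∑ j ∈ J a, w j) * ∑ i ∈ I b, P i :=
                blockPair_kept_le_of_not_depleted (I b) (J a) P w dA N ε₂ hN hε₂.le hP0 hw0
                  (hnodep a b ha hbρ)
            _ ≤ ε₁ * ∑ j ∈ J a, w j + ε₂ * (∑ j ∈ J a, w j) * ∑ i ∈ I b, P i :=
                le_add_of_nonneg_left (mul_nonneg hε₁.le (hσ0 a))
      calc ∑ b, (N - 1) * ∑ i ∈ I b, P i * ∑ j ∈ J a, w j * (1 / N - dA i j)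
          ≤ ∑ b, (ε₁ * ∑ j ∈ J a, w j + ε₂ * (∑ j ∈ J a, w j) * ∑ i ∈ I b, P i) :=
            Finset.sum_le_sum fun b _ => hb b
        _ = m * (ε₁ * ∑ j ∈ J a, w j) + ε₂ * (∑ j ∈ J a, w j) * R := by
            rw [Finset.sum_add_distrib, Finset.sum_const, Finset.card_univ, Fintype.card_fin,
              nsmul_eq_mul, ← Finset.mul_sum, hRρ]
        _ ≤ 3 * G * (ε₁ * ∑ j ∈ J a, w j) + ε₂ * (∑ j ∈ J a, w j) * R :=
            add_le_add (mul_le_mul_of_nonneg_right hm (mul_nonneg hε₁.le (hσ0 a))) le_rfl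
        _ = (3 * G * ε₁ + ε₂ * R) * ∑ j ∈ J a, w j := by ring
        _ ≤ ε₁ * R + (3 * G * ε₁ + ε₂ * R) * ∑ j ∈ J a, w j :=
            le_add_of_nonneg_left (mul_nonneg hε₁.le hR0)
  /- all levels of `w` together -/
  have htot : (N - 1) * ∑ a, ∑ i ∈ F, P i * ∑ j ∈ J a, w j * (1 / N - dA i j) ≤
      3 * G * (ε₁ * R) + (3 * G * ε₁ + ε₂ * R) := by
    rw [Finset.mul_sum]
    calc ∑ a, (N - 1) * ∑ i ∈ F, P i * ∑ j ∈ J a, w j * (1 / N - dA i j)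
        ≤ ∑ a, (ε₁ * R + (3 * G * ε₁ + ε₂ * R) * ∑ j ∈ J a, w j) :=
          Finset.sum_le_sum fun a _ => hlevel a
      _ = m * (ε₁ * R) + (3 * G * ε₁ + ε₂ * R) * ∑ a, ∑ j ∈ J a, w j := by
          rw [Finset.sum_add_distrib, Finset.sum_const, Finset.card_univ, Fintype.card_fin,
            nsmul_eq_mul, ← Finset.mul_sum]
      _ ≤ 3 * G * (ε₁ * R) + (3 * G * ε₁ + ε₂ * R) * 1 :=
          add_le_add (mul_le_mul_of_nonneg_right hm (mul_nonneg hε₁.le hR0))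
            (mul_le_mul_of_nonneg_left hσ1 hcoef)
      _ = 3 * G * (ε₁ * R) + (3 * G * ε₁ + ε₂ * R) := by rw [mul_one]
  /- conclusion -/
  rw [hexp, mul_add]
  have hGR : 0 ≤ G * ε₁ * R := mul_nonneg (mul_nonneg hG0 hε₁.le) hR0
  have hGε : 0 ≤ G * ε₁ := mul_nonneg hG0 hε₁.le
  linarith

/-! ## Substantial pairs with a big `S`-level are not depleted -/

/-- **A substantial pair with a big `S`-level is not depleted.**  For non-empty `S, T ⊆ S_n` with
`(s,t) ↦ s⁻¹t` injective on `S × T` (profile `dA`), the heavy row `pC(k,·)` of a profile `dC ≤ 1`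
(threshold `θC ≥ 16/n`), a weight `w ≤ min(1, 16/n)`, heavy cells `I` of one dyadic level `b` of
`dC(k,·)` with `|I| > 32A₀/(ε₁ n)` and cells `J` of one level `a` of `w ≥ 1/n²` with `Σ_J w ≥ ε₁`:
`Σ_{I×J} dA w pC > (1-ε₂)(Σ_J w)(Σ_I pC)/n` — else the flat block has area `|I||J| ≤ A₀`
(`area_le_of_depleted_flat_block`), while `|J| ≥ ε₁ n/16` gives `|I||J| > 2A₀`. [folklore] -/
theorem subuniform_pair_not_depleted {n : ℕ} (hn : 2 ≤ n) {S T U : Finset (Equiv.Perm (Fin n))}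
    (hS0 : S.Nonempty) (hT0 : T.Nonempty)
    (hinj : Set.InjOn (fun st : Equiv.Perm (Fin n) × Equiv.Perm (Fin n) => st.1⁻¹ * st.2)
      (↑S ×ˢ ↑T : Set (Equiv.Perm (Fin n) × Equiv.Perm (Fin n))))
    (dA dC pC : Fin n → Fin n → ℝ)
    (hdA : ∀ i j, dA i j =
      (((S ×ˢ T).filter fun st => st.2 j = st.1 i).card : ℝ) / (S.card * T.card : ℕ))
    (hdC : ∀ k i, dC k i =
      (((U ×ˢ S).filter fun us => us.2 i = us.1 k).card : ℝ) / (U.card * S.card : ℕ))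
    (θC : ℝ) (hθC : 16 / (n : ℝ) ≤ θC)
    (hpC : ∀ k i, pC k i = if θC ≤ dC k i then dC k i - 1 / n else 0)
    (k : Fin n) (ε₁ ε₂ A₀ : ℝ) (hε₁ : 0 < ε₁) (hε₂ : 0 < ε₂) (hε₂1 : ε₂ ≤ 1)
    (hA₀ : 5000 * n * (1 + Real.log n) *
      Real.log (4 * ((n.factorial : ℝ) / (S.card * T.card : ℕ)) / ε₂) / ε₂ ^ 2 ≤ A₀)
    (w : Fin n → ℝ) (hw1 : ∀ j, w j ≤ 1) (hw16 : ∀ j, w j ≤ 16 / n)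
    (I J : Finset (Fin n)) (a b : ℕ)
    (hI : ∀ i ∈ I, θC ≤ dC k i ∧ ⌊Real.logb 2 (1 / dC k i)⌋₊ = b)
    (hJ : ∀ j ∈ J, 1 / (n : ℝ) ^ 2 ≤ w j ∧ ⌊Real.logb 2 (1 / w j)⌋₊ = a)
    (hbigI : 32 * A₀ / (ε₁ * n) < (I.card : ℝ)) (hσ : ε₁ ≤ ∑ j ∈ J, w j) :
    (1 - ε₂) * ((∑ j ∈ J, w j) * (∑ i ∈ I, pC k i)) / n <
      ∑ i ∈ I, ∑ j ∈ J, dA i j * w j * pC k i := by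
  have hn1 : 1 ≤ n := by omega
  have hn0 : 0 < n := by omega
  have hnR : (0 : ℝ) < n := by exact_mod_cast hn0
  have hdC1 : ∀ i, dC k i ≤ 1 := fun i => by rw [hdC]; exact pairDensity_le_one U S _
  have hθ0 : 0 < θC := lt_of_lt_of_le (by positivity) hθC
  have hN2 : (0 : ℝ) < 1 / (n : ℝ) ^ 2 := by positivity
  /- flatness: `w ∈ [β, 4β]` on `J`, `pC(k,·) ∈ [15γ/16, 4·15γ/16]` on `I` -/
  have hβ0 : 0 < max ((1 / 2 : ℝ) ^ (a + 1)) (1 / (n : ℝ) ^ 2) := lt_max_of_lt_right hN2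
  have hp : ∀ j ∈ J, max ((1 / 2 : ℝ) ^ (a + 1)) (1 / (n : ℝ) ^ 2) ≤ w j ∧
      w j ≤ 4 * max ((1 / 2 : ℝ) ^ (a + 1)) (1 / (n : ℝ) ^ 2) := by
    intro j hj
    have hflat := levelBlock_flat w (1 / (n : ℝ) ^ 2) hN2 hw1 a j
      (Finset.mem_filter.2 ⟨Finset.mem_univ _, hJ j hj⟩)
    exact ⟨hflat.1, hflat.2.trans (by linarith)⟩
  have hq : ∀ i ∈ I, 15 / 16 * max ((1 / 2 : ℝ) ^ (b + 1)) θC ≤ pC k i ∧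
      pC k i ≤ 4 * (15 / 16 * max ((1 / 2 : ℝ) ^ (b + 1)) θC) := by
    intro i hi
    obtain ⟨hθi, hli⟩ := hI i hi
    have hflat := levelBlock_flat (fun i => dC k i) θC hθ0 hdC1 b i
      (Finset.mem_filter.2 ⟨Finset.mem_univ _, hθi, hli⟩)
    have hk := heavy_kept_bounds hn0 θC (dC k i) hθC hθi
    have h1n : (0 : ℝ) ≤ 1 / n := by positivity
    have hγ0 : 0 < max ((1 / 2 : ℝ) ^ (b + 1)) θC := lt_max_of_lt_right hθ0
    rw [hpC, if_pos hθi]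
    constructor
    · linarith [hflat.1, hk.2]
    · linarith [hflat.2]
  /- if the pair were depleted, the block would be small ... -/
  by_contra hdep
  push Not at hdep
  have harea := area_le_of_depleted_flat_block hn1 S T hS0 hT0 hinj dA hdA I J w (fun i => pC k i)
    _ _ ε₂ hβ0 (by positivity) hε₂ hε₂1 hp hq hdep
  have hIJ : (I.card : ℝ) * J.card ≤ A₀ := by
    have h := harea.trans hA₀
    rwa [Nat.cast_mul] at h
  /- ... but `J` is large (`w ≤ 16/n`, `Σ_J w ≥ ε₁`) and so is `I` (`hbigI`) -/
  have hJcard : ε₁ * n / 16 ≤ (J.card : ℝ) := by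
    have h1 := Finset.sum_le_card_nsmul J w _ fun j _ => hw16 j
    have h2 : ε₁ ≤ J.card * (16 / n) := hσ.trans (by rwa [nsmul_eq_mul] at h1)
    rw [← mul_div_assoc, le_div_iff₀ hnR] at h2
    linarith
  have hA0 : 0 ≤ A₀ := le_trans (by positivity) hIJ
  have hpos : 0 < ε₁ * n / 16 := by positivity
  have hlt : 32 * A₀ / (ε₁ * n) * (ε₁ * n / 16) < (I.card : ℝ) * J.card :=
    mul_lt_mul hbigI hJcard hpos (Nat.cast_nonneg _)
  have e : 32 * A₀ / (ε₁ * n) * (ε₁ * n / 16) = 2 * A₀ := by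
    field_simp [hε₁.ne', hnR.ne']
    ring
  rw [e] at hlt
  linarith

/-! ## The stub -/

/-- **The sub-uniform part of a column keeps almost nothing.** For a TPP triple `S, T, U ⊆ S_n`
(`n ≥ 2`), a position `k`, a mask `Qm`, the heavy row `pC(k,·)` at threshold `θC ≥ 16/n`, the
sub-uniform column weight `w j = if 16/n ≤ dB(j,k) then 1/n else dB(j,k)`, parameters
`0 < ε₁`, `0 < ε₂ ≤ 1`, `A₀ ≥ 5000 n (1+log n) log(4K_A/ε₂)/ε₂²`, and no small substantial masked
S-level (`hbig`):
`(n-1) Σ_{i ∉ Qm} pC(k,i) Σ_j w j (1/n - dA(i,j)) ≤ ε₂ R + 5(1+log n) ε₁ (R+1) + R/n`,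
`R = Σ_{i ∉ Qm} pC(k,i)`. [folklore] -/
theorem subuniform_kept_le {n : ℕ} (hn : 2 ≤ n) {S T U : Finset (Equiv.Perm (Fin n))}
    (hTPP : TripleProductProperty S T U) (hS0 : S.Nonempty) (hT0 : T.Nonempty) (hU0 : U.Nonempty)
    (dA dB dC pC : Fin n → Fin n → ℝ)
    (hdA : ∀ i j, dA i j =
      (((S ×ˢ T).filter fun st => st.2 j = st.1 i).card : ℝ) / (S.card * T.card : ℕ))
    (hdB : ∀ j k, dB j k =
      (((T ×ˢ U).filter fun tu => tu.2 k = tu.1 j).card : ℝ) / (T.card * U.card : ℕ))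
    (hdC : ∀ k i, dC k i =
      (((U ×ˢ S).filter fun us => us.2 i = us.1 k).card : ℝ) / (U.card * S.card : ℕ))
    (θC : ℝ) (hθC : 16 / (n : ℝ) ≤ θC)
    (hpC : ∀ k i, pC k i = if θC ≤ dC k i then dC k i - 1 / n else 0)
    (k : Fin n) (Qm : Finset (Fin n)) (ε₁ ε₂ A₀ : ℝ) (hε₁ : 0 < ε₁) (hε₂ : 0 < ε₂) (hε₂1 : ε₂ ≤ 1)
    (hA₀ : 5000 * n * (1 + Real.log n) *
      Real.log (4 * ((n.factorial : ℝ) / (S.card * T.card : ℕ)) / ε₂) / ε₂ ^ 2 ≤ A₀)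
    (hbig : ∀ b : Fin (⌊Real.logb 2 ((n : ℝ) ^ 2)⌋₊ + 1),
      ε₁ ≤ ∑ i ∈ Finset.univ.filter
          (fun i => i ∉ Qm ∧ θC ≤ dC k i ∧ ⌊Real.logb 2 (1 / dC k i)⌋₊ = b.val), pC k i →
        32 * A₀ / (ε₁ * n) < ((Finset.univ.filter
          (fun i => i ∉ Qm ∧ θC ≤ dC k i ∧ ⌊Real.logb 2 (1 / dC k i)⌋₊ = b.val)).card : ℝ)) :
    ((n : ℝ) - 1) * ∑ i ∈ Finset.univ.filter (fun i => i ∉ Qm), pC k i *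
        ∑ j : Fin n, (if 16 / (n : ℝ) ≤ dB j k then 1 / (n : ℝ) else dB j k) * (1 / n - dA i j) ≤
      ε₂ * (∑ i ∈ Finset.univ.filter (fun i => i ∉ Qm), pC k i) +
        5 * (1 + Real.log n) * ε₁ * ((∑ i ∈ Finset.univ.filter (fun i => i ∉ Qm), pC k i) + 1) +
        (∑ i ∈ Finset.univ.filter (fun i => i ∉ Qm), pC k i) / n := by
  have hn1 : 1 ≤ n := by omega
  have hn0 : 0 < n := by omega
  have hnR : (0 : ℝ) < n := by exact_mod_cast hn0
  have hnR1 : (1 : ℝ) ≤ n := by exact_mod_cast hn1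
  /- the profiles: `dA ≥ 0`, `0 ≤ dB ≤ 1`, `Σ_j dB(j,k) = 1`, `dC ≤ 1`, `pC ≥ 0` -/
  have hdA0 : ∀ i j, 0 ≤ dA i j := fun i j => by rw [hdA]; positivity
  have hdB0 : ∀ j, 0 ≤ dB j k := fun j => by rw [hdB]; positivity
  have hdB1 : ∀ j, dB j k ≤ 1 := fun j => by rw [hdB]; exact pairDensity_le_one T U _
  have hdC1 : ∀ i, dC k i ≤ 1 := fun i => by rw [hdC]; exact pairDensity_le_one U S _
  have hdBsum : ∑ j, dB j k = 1 := by
    simp_rw [hdB]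
    rw [← Finset.sum_div, ← Nat.cast_sum, sum_pairMarginal_fst T U k]
    exact div_self (by exact_mod_cast (Nat.mul_pos hT0.card_pos hU0.card_pos).ne')
  have hpC0 : ∀ i, 0 ≤ pC k i := fun i => kept_nonneg hn0 θC _ _ hθC (hpC k i)
  have hpCz : ∀ i, ¬θC ≤ dC k i → pC k i = 0 := fun i hi => by rw [hpC, if_neg hi]
  /- the sub-uniform weight `w`: `0 ≤ w ≤ dB`, `w ≤ 1`, `w ≤ 16/n`, `Σ w ≤ 1` -/
  obtain ⟨w, hw⟩ : ∃ w : Fin n → ℝ, ∀ j,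
      w j = if 16 / (n : ℝ) ≤ dB j k then 1 / (n : ℝ) else dB j k := ⟨_, fun _ => rfl⟩
  have h1n : (0 : ℝ) ≤ 1 / n := by positivity
  have h16 : 1 / (n : ℝ) ≤ 16 / n := div_le_div_of_nonneg_right (by norm_num) hnR.le
  have hw0 : ∀ j, 0 ≤ w j := fun j => by rw [hw]; split_ifs; exacts [h1n, hdB0 j]
  have hwdB : ∀ j, w j ≤ dB j k := fun j => by
    rw [hw]; split_ifs with h; exacts [h16.trans h, le_rfl]
  have hw1 : ∀ j, w j ≤ 1 := fun j => (hwdB j).trans (hdB1 j)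
  have hw16 : ∀ j, w j ≤ 16 / n := fun j => by
    rw [hw]; split_ifs with h; exacts [h16, (not_le.1 h).le]
  have hwsum : ∑ j, w j ≤ 1 := (Finset.sum_le_sum fun j _ => hwdB j).trans hdBsum.le
  /- the two splittings: dust + levels of `w`, and the masked levels of `dC(k,·)` -/
  have hsplitJ : ∀ f : Fin n → ℝ, ∑ j, w j * f j =
      ∑ j ∈ Finset.univ.filter (fun j => ¬(1 / (n : ℝ) ^ 2 ≤ w j)), w j * f j +
        ∑ a : Fin (⌊Real.logb 2 ((n : ℝ) ^ 2)⌋₊ + 1), ∑ j ∈ Finset.univ.filter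
          (fun j => 1 / (n : ℝ) ^ 2 ≤ w j ∧ ⌊Real.logb 2 (1 / w j)⌋₊ = a.val), w j * f j := by
    intro f
    rw [← sum_heavy_eq_sum_levels hn1 w (1 / (n : ℝ) ^ 2) le_rfl hw1 (fun j => w j * f j),
      add_comm]
    exact (Finset.sum_filter_add_sum_filter_not _ _ _).symm
  have hsplitI : ∀ g : Fin n → ℝ, ∑ i ∈ Finset.univ.filter (fun i => i ∉ Qm), pC k i * g i =
      ∑ b : Fin (⌊Real.logb 2 ((n : ℝ) ^ 2)⌋₊ + 1), ∑ i ∈ Finset.univ.filter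
        (fun i => i ∉ Qm ∧ θC ≤ dC k i ∧ ⌊Real.logb 2 (1 / dC k i)⌋₊ = b.val), pC k i * g i := by
    intro g
    rw [Finset.sum_filter, sum_eq_sum_levels_of_vanish hn1 (fun i => dC k i) θC hθC hdC1
      (fun i => if i ∉ Qm then pC k i * g i else 0) (fun i hi => by simp [hpCz i hi])]
    refine Finset.sum_congr rfl fun b _ => ?_
    rw [← Finset.sum_filter, Finset.filter_filter]
    exact Finset.sum_congr (Finset.filter_congr fun i _ => and_comm) fun _ _ => rfl
  /- assemble: the bookkeeping, with the substantial pairs non-depleted -/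
  simp only [← hw]
  exact subuniform_kept_bookkeeping (n : ℝ) (1 + Real.log n) ε₁ ε₂ _ hnR1 (dyadicLevel_count n hn1)
    hε₁ hε₂ (fun i => pC k i) w dA (Finset.univ.filter fun i => i ∉ Qm)
    (Finset.univ.filter fun j => ¬(1 / (n : ℝ) ^ 2 ≤ w j))
    (fun b => Finset.univ.filter
      (fun i => i ∉ Qm ∧ θC ≤ dC k i ∧ ⌊Real.logb 2 (1 / dC k i)⌋₊ = b.val))
    (fun a => Finset.univ.filter
      (fun j => 1 / (n : ℝ) ^ 2 ≤ w j ∧ ⌊Real.logb 2 (1 / w j)⌋₊ = a.val))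
    rfl hpC0 hw0 hwsum hdA0 (fun j hj => (not_le.1 (Finset.mem_filter.1 hj).2).le)
    (by exact_mod_cast (Finset.card_le_univ _).trans (Fintype.card_fin n).le) hsplitJ hsplitI
    (fun a b ha hb => subuniform_pair_not_depleted hn hS0 hT0 (injOn_quot_first hTPP hU0) dA dC pC
      hdA hdC θC hθC hpC k ε₁ ε₂ A₀ hε₁ hε₂ hε₂1 hA₀ w hw1 hw16 _ _ a.val b.val
      (fun i hi => (Finset.mem_filter.1 hi).2.2) (fun j hj => (Finset.mem_filter.1 hj).2)
      (hbig b hb) ha)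

end Summit.MatrixMultiplication.MatrixMultiplication.Theorems.PolynomialSlack
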